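import Summits.HubbardSuperconductivity.HubbardSuperconductivity.Theorems.AnisotropyChordKnnTopSectors

/-!
# Route `AnisotropyChord` / H0 rotor rung, K_{n,n} sibling of XY-LM₀: THEOREM Q — the top non-trivial link
# `g(2s−3) ≤ g(2s−2)` for EVERY `n = 2s ≥ 3` and EVERY anisotropy `η = 1 − Δ > 0`
(prover seat `hubbard-h0-rotor-p1` g13; Lean port of theory seat `hubbard-h0-rotor-theory-1`'s THEOREM Q, THEOREMS M13, memo
ROTOR-THEORY-11 §163 — with a proof valid for all `η > 0`: the memo's monotonicity-in-`(q, δ)` argument needs `δ > 0`,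
which fails for `η > (2n−1)²`; here the two closed forms `δ(2s−2) = (2n−1) − η/(2n−1)`, `δ(2s−3) = (2n−1) − 2η(n+1)/(2n−1)`,
`q(2s−3)² : q(2s−2)² = 3(n−2) : (n−1)` are compared directly.)

For `|M| ∈ {2s−3, 2s−2}` the block has the two levels `J ∈ {2s−2, 2s}`; for a two-level Jacobi block `[[p₀, q],[q, p₁]]`
the top vector's ratio `r = x₀/x₁` solves `q(1 − r²) = δ r` (`δ = p₁ − p₀`), so `r` is decreasing in `t = δ/q`, and
`⟨J(J+1)⟩ = f₁ − (f₁ − f₀) r²/(1 + r²)` is decreasing in `r`.  The link follows from `t(2s−3) ≤ t(2s−2)`.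
-/

set_option linter.dupNamespace false
set_option autoImplicit false

noncomputable section

open Finset Matrix

namespace Summit.HubbardSuperconductivity.HubbardSuperconductivity.Theorems.AnisotropyChord.Knn

/-! ## Two-level Jacobi blocks -/

/-- eigen-relation of a two-level block: `q (x₁² − x₀²) = (p₁ − p₀) x₀ x₁`. [folklore] -/
theorem two_level_relation {p c : ℕ → ℝ} {x : Fin 2 → ℝ} (hx : IsTopVector (jac 2 p c) x) :
    c 0 * (ext0 x 1 ^ 2 - ext0 x 0 ^ 2) = (p 1 - p 0) * (ext0 x 0 * ext0 x 1) := by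
  have r0 := eigen_row_of_isTopVector hx ⟨0, by omega⟩
  have r1 := eigen_row_of_isTopVector hx ⟨1, by omega⟩
  have e2 : ext0 x 2 = 0 := ext0_of_le x le_rfl
  norm_num [e2] at r0 r1
  linear_combination (ext0 x 0) * r1 - (ext0 x 1) * r0

/-- ratio comparison for two-level blocks: `q(1−r²) = δ r`, `q'(1−r'²) = δ' r'`, `δ q' ≤ δ' q` ⇒ `r' ≤ r`
(`t = δ/q = 1/r − r` is decreasing in `r`). [folklore] -/
theorem two_level_ratio_le {c c' δ δ' r r' : ℝ} (hc : 0 < c) (hc' : 0 < c') (hr : 0 < r) (hr' : 0 < r')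
    (h : c * (1 - r ^ 2) = δ * r) (h' : c' * (1 - r' ^ 2) = δ' * r') (hcmp : δ * c' ≤ δ' * c) : r' ≤ r := by
  have h1 : δ * r * (c' * r') ≤ δ' * r' * (c * r) := by
    have := mul_le_mul_of_nonneg_right hcmp (mul_nonneg hr.le hr'.le)
    nlinarith
  rw [← h, ← h'] at h1
  have h2 : c * c' * ((r' - r) * (1 + r * r')) ≤ 0 := by
    have e : c * (1 - r ^ 2) * (c' * r') - c' * (1 - r' ^ 2) * (c * r) = c * c' * ((r' - r) * (1 + r * r')) := by
      ring
    linarith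
  have h3 : 0 < c * c' * (1 + r * r') := by positivity
  by_contra hlt
  have : 0 < c * c' * ((r' - r) * (1 + r * r')) := by
    have e : c * c' * ((r' - r) * (1 + r * r')) = (c * c' * (1 + r * r')) * (r' - r) := by ring
    rw [e]; exact mul_pos h3 (by linarith [not_le.mp hlt])
  linarith

/-! ## The two top non-trivial sectors `|M| = n − 3`, `n − 2` of `K_{n,n}` (`n = twoS ≥ 3`) -/

section TopLink

variable {n : ℕ}

/-- `jMin = n − 2` for `M = n − 2`. [folklore] -/
theorem jMin_topM2 (hn : 3 ≤ n) : jMin n ((n - 2 : ℕ) : ℤ) = n - 2 := by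
  unfold jMin; rw [Int.natAbs_natCast]; split_ifs with h <;> omega

/-- `jMin = n − 2` for `M = n − 3`. [folklore] -/
theorem jMin_topM1 (hn : 3 ≤ n) : jMin n ((n - 3 : ℕ) : ℤ) = n - 2 := by
  unfold jMin; rw [Int.natAbs_natCast]; split_ifs with h <;> omega

/-- two levels for `M = n − 2`. [folklore] -/
theorem numLevels_topM2 (hn : 3 ≤ n) : numLevels n ((n - 2 : ℕ) : ℤ) = 2 := by
  unfold numLevels; rw [jMin_topM2 hn]; omega

/-- two levels for `M = n − 3`. [folklore] -/
theorem numLevels_topM1 (hn : 3 ≤ n) : numLevels n ((n - 3 : ℕ) : ℤ) = 2 := by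
  unfold numLevels; rw [jMin_topM1 hn]; omega

/-- `β²_{n−1} = 1/(2n−1)`. [folklore] -/
theorem betaSq_n_sub_one (hn : 3 ≤ n) : betaSq n (n - 1) = 1 / (2 * (n : ℝ) - 1) := by
  unfold betaSq
  have hc : ((n - 1 : ℕ) : ℝ) = (n : ℝ) - 1 := by rw [Nat.cast_sub (by omega)]; simp
  rw [hc]
  have hνpos : (3 : ℝ) ≤ n := by exact_mod_cast hn
  have h1 : (2 : ℝ) * ((n : ℝ) - 1) + 1 ≠ 0 := by linarith
  have h2 : (2 : ℝ) * ((n : ℝ) - 1) + 3 ≠ 0 := by linarith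
  have h3 : (2 : ℝ) * (n : ℝ) - 1 ≠ 0 := by linarith
  rw [div_eq_div_iff (mul_ne_zero h1 h2) h3]
  ring

/-- `β²_{n−2} = 4n/((2n−3)(2n−1))`. [folklore] -/
theorem betaSq_n_sub_two (hn : 3 ≤ n) :
    betaSq n (n - 2) = 4 * (n : ℝ) / ((2 * (n : ℝ) - 3) * (2 * (n : ℝ) - 1)) := by
  unfold betaSq
  have hc : ((n - 2 : ℕ) : ℝ) = (n : ℝ) - 2 := by rw [Nat.cast_sub (by omega)]; simp
  rw [hc]
  have hνpos : (3 : ℝ) ≤ n := by exact_mod_cast hn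
  have h1 : (2 : ℝ) * ((n : ℝ) - 2) + 1 ≠ 0 := by linarith
  have h2 : (2 : ℝ) * ((n : ℝ) - 2) + 3 ≠ 0 := by linarith
  have h3 : (2 : ℝ) * (n : ℝ) - 3 ≠ 0 := by linarith
  have h4 : (2 : ℝ) * (n : ℝ) - 1 ≠ 0 := by linarith
  rw [div_eq_div_iff (mul_ne_zero h1 h2) (mul_ne_zero h3 h4)]
  ring

/-- `β²_{n−3} = 3(2n−1)/((2n−5)(2n−3))`. [folklore] -/
theorem betaSq_n_sub_three (hn : 3 ≤ n) :
    betaSq n (n - 3) = 3 * (2 * (n : ℝ) - 1) / ((2 * (n : ℝ) - 5) * (2 * (n : ℝ) - 3)) := by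
  unfold betaSq
  have hc : ((n - 3 : ℕ) : ℝ) = (n : ℝ) - 3 := by rw [Nat.cast_sub (by omega)]; simp
  rw [hc]
  have hνpos : (3 : ℝ) ≤ n := by exact_mod_cast hn
  have h1 : (2 : ℝ) * ((n : ℝ) - 3) + 1 ≠ 0 := by linarith
  have h2 : (2 : ℝ) * ((n : ℝ) - 3) + 3 ≠ 0 := by linarith
  have h3 : (2 : ℝ) * (n : ℝ) - 5 ≠ 0 := by
    intro h
    have h' : ((2 * n : ℕ) : ℝ) = ((5 : ℕ) : ℝ) := by push_cast; linarith
    have h'' : 2 * n = 5 := by exact_mod_cast h'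
    omega
  have h4 : (2 : ℝ) * (n : ℝ) - 3 ≠ 0 := by linarith
  rw [div_eq_div_iff (mul_ne_zero h1 h2) (mul_ne_zero h3 h4)]
  ring

/-- `q(n−3)²·(4/η)² = b²_{n−2}(n−3) b²_{n−1}(n−3) = 48n(n−2)/(2n−1)²`. [folklore] -/
theorem bSq_prod_topM1 (hn : 3 ≤ n) :
    bSq n ((n - 3 : ℕ) : ℤ) (n - 2) * bSq n ((n - 3 : ℕ) : ℤ) (n - 1)
      = 48 * (n : ℝ) * ((n : ℝ) - 2) / (2 * (n : ℝ) - 1) ^ 2 := by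
  unfold bSq
  rw [if_pos (by omega), if_pos (by omega), betaSq_n_sub_two hn, betaSq_n_sub_one hn]
  have hc2 : ((n - 2 : ℕ) : ℝ) = (n : ℝ) - 2 := by rw [Nat.cast_sub (by omega)]; simp
  have hc1 : ((n - 1 : ℕ) : ℝ) = (n : ℝ) - 1 := by rw [Nat.cast_sub (by omega)]; simp
  have hc3 : (((n - 3 : ℕ) : ℤ) : ℝ) = (n : ℝ) - 3 := by
    rw [Int.cast_natCast, Nat.cast_sub (by omega)]; simp
  rw [hc2, hc1, hc3]
  have hνpos : (3 : ℝ) ≤ n := by exact_mod_cast hn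
  generalize hD3 : (2 : ℝ) * (n : ℝ) - 3 = D3
  generalize hD1 : (2 : ℝ) * (n : ℝ) - 1 = D1
  have h3 : D3 ≠ 0 := by rw [← hD3]; linarith
  have h4 : D1 ≠ 0 := by rw [← hD1]; linarith
  field_simp
  subst hD3 hD1
  ring

/-- `b²_{n−2}(n−2) b²_{n−1}(n−2) = 16n(n−1)/(2n−1)²`. [folklore] -/
theorem bSq_prod_topM2 (hn : 3 ≤ n) :
    bSq n ((n - 2 : ℕ) : ℤ) (n - 2) * bSq n ((n - 2 : ℕ) : ℤ) (n - 1)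
      = 16 * (n : ℝ) * ((n : ℝ) - 1) / (2 * (n : ℝ) - 1) ^ 2 := by
  unfold bSq
  rw [if_pos (by omega), if_pos (by omega), betaSq_n_sub_two hn, betaSq_n_sub_one hn]
  have hc2 : ((n - 2 : ℕ) : ℝ) = (n : ℝ) - 2 := by rw [Nat.cast_sub (by omega)]; simp
  have hc1 : ((n - 1 : ℕ) : ℝ) = (n : ℝ) - 1 := by rw [Nat.cast_sub (by omega)]; simp
  have hc3 : (((n - 2 : ℕ) : ℤ) : ℝ) = (n : ℝ) - 2 := by
    rw [Int.cast_natCast, Nat.cast_sub (by omega)]; simp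
  rw [hc2, hc1, hc3]
  have hνpos : (3 : ℝ) ≤ n := by exact_mod_cast hn
  generalize hD3 : (2 : ℝ) * (n : ℝ) - 3 = D3
  generalize hD1 : (2 : ℝ) * (n : ℝ) - 1 = D1
  have h3 : D3 ≠ 0 := by rw [← hD3]; linarith
  have h4 : D1 ≠ 0 := by rw [← hD1]; linarith
  field_simp
  subst hD3 hD1
  ring

/-- the diagonal gap `δ(M) = p₁(M) − p₀(M)` of the two-level blocks, in terms of `b²`. [folklore] -/
theorem delta_top_eq (hn : 3 ≤ n) (M : ℤ) (hj : jMin n M = n - 2) (η : ℝ) :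
    pK n M η 1 - pK n M η 0
      = (2 * (n : ℝ) - 1) + η / 4 * (bSq n M (n - 1) - bSq n M (n - 3) - bSq n M (n - 2)) := by
  unfold pK lev
  rw [hj]
  have e1 : n - 2 + 2 * 1 = n := by omega
  have e0 : n - 2 + 2 * 0 = n - 2 := by omega
  rw [e1, e0]
  have htop : bSq n M n = 0 := by unfold bSq; rw [if_neg (by omega)]
  have hp1 : bSqPred n M n = bSq n M (n - 1) := by unfold bSqPred; rw [if_neg (by omega)]
  have hp0 : bSqPred n M (n - 2) = bSq n M (n - 3) := by
    unfold bSqPred; rw [if_neg (by omega)]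
    have : n - 2 - 1 = n - 3 := by omega
    rw [this]
  rw [htop, hp1, hp0]
  have hc2 : ((n - 2 : ℕ) : ℝ) = (n : ℝ) - 2 := by rw [Nat.cast_sub (by omega)]; simp
  rw [hc2]
  ring

/-- `δ(n−2) = (2n−1) − η/(2n−1)`. [folklore] -/
theorem delta_topM2 (hn : 3 ≤ n) (η : ℝ) :
    pK n ((n - 2 : ℕ) : ℤ) η 1 - pK n ((n - 2 : ℕ) : ℤ) η 0 = (2 * (n : ℝ) - 1) - η / (2 * (n : ℝ) - 1) := by
  rw [delta_top_eq hn _ (jMin_topM2 hn)]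
  unfold bSq
  rw [if_pos (by omega), if_pos (by omega), if_pos (by omega), betaSq_n_sub_two hn, betaSq_n_sub_one hn]
  have hc2 : ((n - 2 : ℕ) : ℝ) = (n : ℝ) - 2 := by rw [Nat.cast_sub (by omega)]; simp
  have hc1 : ((n - 1 : ℕ) : ℝ) = (n : ℝ) - 1 := by rw [Nat.cast_sub (by omega)]; simp
  have hc3n : ((n - 3 : ℕ) : ℝ) = (n : ℝ) - 3 := by rw [Nat.cast_sub (by omega)]; simp
  have hc3 : (((n - 2 : ℕ) : ℤ) : ℝ) = (n : ℝ) - 2 := by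
    rw [Int.cast_natCast, Nat.cast_sub (by omega)]; simp
  rw [hc2, hc1, hc3n, hc3]
  have hνpos : (3 : ℝ) ≤ n := by exact_mod_cast hn
  generalize hD5 : (2 : ℝ) * (n : ℝ) - 5 = D5
  generalize hD3 : (2 : ℝ) * (n : ℝ) - 3 = D3
  generalize hD1 : (2 : ℝ) * (n : ℝ) - 1 = D1
  have h2 : D5 ≠ 0 := by
    rw [← hD5]; intro h
    have h' : ((2 * n : ℕ) : ℝ) = ((5 : ℕ) : ℝ) := by push_cast; linarith
    have h'' : 2 * n = 5 := by exact_mod_cast h'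
    omega
  have h3 : D3 ≠ 0 := by rw [← hD3]; linarith
  have h4 : D1 ≠ 0 := by rw [← hD1]; linarith
  field_simp
  subst hD5 hD3 hD1
  ring

/-- `δ(n−3) = (2n−1) − 2η(n+1)/(2n−1)`. [folklore] -/
theorem delta_topM1 (hn : 3 ≤ n) (η : ℝ) :
    pK n ((n - 3 : ℕ) : ℤ) η 1 - pK n ((n - 3 : ℕ) : ℤ) η 0
      = (2 * (n : ℝ) - 1) - 2 * η * ((n : ℝ) + 1) / (2 * (n : ℝ) - 1) := by
  rw [delta_top_eq hn _ (jMin_topM1 hn)]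
  unfold bSq
  rw [if_pos (by omega), if_pos (by omega), if_pos (by omega), betaSq_n_sub_two hn, betaSq_n_sub_one hn,
    betaSq_n_sub_three hn]
  have hc2 : ((n - 2 : ℕ) : ℝ) = (n : ℝ) - 2 := by rw [Nat.cast_sub (by omega)]; simp
  have hc1 : ((n - 1 : ℕ) : ℝ) = (n : ℝ) - 1 := by rw [Nat.cast_sub (by omega)]; simp
  have hc3n : ((n - 3 : ℕ) : ℝ) = (n : ℝ) - 3 := by rw [Nat.cast_sub (by omega)]; simp
  have hc3 : (((n - 3 : ℕ) : ℤ) : ℝ) = (n : ℝ) - 3 := by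
    rw [Int.cast_natCast, Nat.cast_sub (by omega)]; simp
  rw [hc2, hc1, hc3n, hc3]
  have hνpos : (3 : ℝ) ≤ n := by exact_mod_cast hn
  generalize hD5 : (2 : ℝ) * (n : ℝ) - 5 = D5
  generalize hD3 : (2 : ℝ) * (n : ℝ) - 3 = D3
  generalize hD1 : (2 : ℝ) * (n : ℝ) - 1 = D1
  have h2 : D5 ≠ 0 := by
    rw [← hD5]; intro h
    have h' : ((2 * n : ℕ) : ℝ) = ((5 : ℕ) : ℝ) := by push_cast; linarith
    have h'' : 2 * n = 5 := by exact_mod_cast h'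
    omega
  have h3 : D3 ≠ 0 := by rw [← hD3]; linarith
  have h4 : D1 ≠ 0 := by rw [← hD1]; linarith
  field_simp
  subst hD5 hD3 hD1
  ring

/-- **the comparison `t(n−3) ≤ t(n−2)`, cross-multiplied: `δ(n−3)·q(n−2) ≤ δ(n−2)·q(n−3)` for every `η > 0`.** [folklore] -/
theorem delta_mul_c_le (hn : 3 ≤ n) {η : ℝ} (hη : 0 < η) :
    (pK n ((n - 3 : ℕ) : ℤ) η 1 - pK n ((n - 3 : ℕ) : ℤ) η 0) * cK n ((n - 2 : ℕ) : ℤ) η 0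
      ≤ (pK n ((n - 2 : ℕ) : ℤ) η 1 - pK n ((n - 2 : ℕ) : ℤ) η 0) * cK n ((n - 3 : ℕ) : ℤ) η 0 := by
  rw [delta_topM1 hn, delta_topM2 hn]
  unfold cK lev
  rw [jMin_topM1 hn, jMin_topM2 hn]
  have e0 : n - 2 + 2 * 0 = n - 2 := by omega
  have e1 : n - 2 + 1 = n - 1 := by omega
  rw [e0, e1, bSq_prod_topM1 hn, bSq_prod_topM2 hn]
  have hν : (3 : ℝ) ≤ n := by exact_mod_cast hn
  set ν : ℝ := (n : ℝ) with hνdef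
  have hD : 0 < 2 * ν - 1 := by linarith
  set A1 : ℝ := 48 * ν * (ν - 2) / (2 * ν - 1) ^ 2 with hA1
  set A2 : ℝ := 16 * ν * (ν - 1) / (2 * ν - 1) ^ 2 with hA2
  have hA2nn : 0 ≤ A2 := by rw [hA2]; apply div_nonneg _ (by positivity); nlinarith
  have hA1nn : 0 ≤ A1 := by
    rw [hA1]; apply div_nonneg _ (by positivity); nlinarith
  -- S1: √A2 ≤ √A1
  have S1 : Real.sqrt A2 ≤ Real.sqrt A1 := by
    apply Real.sqrt_le_sqrt
    rw [hA1, hA2]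
    apply div_le_div_of_nonneg_right _ (by positivity)
    nlinarith
  -- S2: √A1 ≤ 2(ν+1) √A2
  have S2 : Real.sqrt A1 ≤ 2 * (ν + 1) * Real.sqrt A2 := by
    have hpos : 0 ≤ 2 * (ν + 1) := by linarith
    rw [← Real.sqrt_sq hpos, ← Real.sqrt_mul (sq_nonneg _)]
    apply Real.sqrt_le_sqrt
    rw [hA1, hA2, mul_div_assoc']
    apply div_le_div_of_nonneg_right _ (by positivity)
    nlinarith
  have hsA1 := Real.sqrt_nonneg A1
  have hsA2 := Real.sqrt_nonneg A2
  -- δ₂ √A1 − δ₁ √A2 = (2ν−1)(√A1 − √A2) + (η/(2ν−1))(2(ν+1)√A2 − √A1) ≥ 0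
  have key : (2 * ν - 1 - 2 * η * (ν + 1) / (2 * ν - 1)) * Real.sqrt A2
      ≤ (2 * ν - 1 - η / (2 * ν - 1)) * Real.sqrt A1 := by
    have e : (2 * ν - 1 - η / (2 * ν - 1)) * Real.sqrt A1 - (2 * ν - 1 - 2 * η * (ν + 1) / (2 * ν - 1)) * Real.sqrt A2
        = (2 * ν - 1) * (Real.sqrt A1 - Real.sqrt A2) + (η / (2 * ν - 1)) * (2 * (ν + 1) * Real.sqrt A2 - Real.sqrt A1) := by
      ring
    have t1 : 0 ≤ (2 * ν - 1) * (Real.sqrt A1 - Real.sqrt A2) := mul_nonneg hD.le (by linarith)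
    have t2 : 0 ≤ (η / (2 * ν - 1)) * (2 * (ν + 1) * Real.sqrt A2 - Real.sqrt A1) :=
      mul_nonneg (div_nonneg hη.le hD.le) (by linarith)
    linarith
  have hη4 : 0 ≤ η / 4 := by positivity
  calc (2 * ν - 1 - 2 * η * (ν + 1) / (2 * ν - 1)) * (η / 4 * Real.sqrt A2)
      = η / 4 * ((2 * ν - 1 - 2 * η * (ν + 1) / (2 * ν - 1)) * Real.sqrt A2) := by ring
    _ ≤ η / 4 * ((2 * ν - 1 - η / (2 * ν - 1)) * Real.sqrt A1) := mul_le_mul_of_nonneg_left key hη4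
    _ = (2 * ν - 1 - η / (2 * ν - 1)) * (η / 4 * Real.sqrt A1) := by ring

/-- **THEOREM Q (theory seat THEOREMS M13), the non-trivial top link, Lean, ALL `n ≥ 3`, ALL `η > 0`:**
`⟨J(J+1)⟩` in the top vector of `P_{n−3}(η)` is at most that of `P_{n−2}(η)` (`g(2s−3) ≤ g(2s−2)`).
[conjecture: theory seat hubbard-h0-rotor-theory-1, cycle 11 — THEOREM Q (M13), paper-proved; Lean proof here (all η > 0)] -/
theorem casimirMean_le_topLink (hn : 3 ≤ n) {η : ℝ} (hη : 0 < η)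
    {x : Fin (numLevels n ((n - 3 : ℕ) : ℤ)) → ℝ} {x' : Fin (numLevels n ((n - 2 : ℕ) : ℤ)) → ℝ}
    (hx : IsTopVector (knnBlock n ((n - 3 : ℕ) : ℤ) η) x) (hx' : IsTopVector (knnBlock n ((n - 2 : ℕ) : ℤ) η) x') :
    casimirMean n ((n - 3 : ℕ) : ℤ) x ≤ casimirMean n ((n - 2 : ℕ) : ℤ) x' := by
  rw [knnBlock_eq_jac] at hx hx'
  have h1 := numLevels_topM1 hn
  have h2 := numLevels_topM2 hn
  have habs1 : (((n - 3 : ℕ) : ℤ)).natAbs ≤ n := by rw [Int.natAbs_natCast]; omega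
  have habs2 : (((n - 2 : ℕ) : ℤ)).natAbs ≤ n := by rw [Int.natAbs_natCast]; omega
  -- re-index both top vectors to `Fin 2`
  have hy := isTopVector_cast h1 hx
  have hy' := isTopVector_cast h2 hx'
  set y : Fin 2 → ℝ := fun k => x (Fin.cast h1.symm k) with hydef
  set y' : Fin 2 → ℝ := fun k => x' (Fin.cast h2.symm k) with hy'def
  have hey : ext0 y = ext0 x := ext0_comp_cast h1 x
  have hey' : ext0 y' = ext0 x' := ext0_comp_cast h2 x'
  -- positivity of couplings and entries
  have hc : ∀ k, k + 1 < 2 → 0 < cK n ((n - 3 : ℕ) : ℤ) η k := by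
    intro k hk
    have hk0 : k = 0 := by omega
    subst hk0
    exact cK_pos habs1 hη (by rw [h1]; omega)
  have hc' : ∀ k, k + 1 < 2 → 0 < cK n ((n - 2 : ℕ) : ℤ) η k := by
    intro k hk
    have hk0 : k = 0 := by omega
    subst hk0
    exact cK_pos habs2 hη (by rw [h2]; omega)
  have he0 : 0 < ext0 y 0 := by rw [ext0_of_lt y (by omega)]; exact isTopVector_pos hc hy ⟨0, by omega⟩
  have he1 : 0 < ext0 y 1 := by rw [ext0_of_lt y (by omega)]; exact isTopVector_pos hc hy ⟨1, by omega⟩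
  have he0' : 0 < ext0 y' 0 := by rw [ext0_of_lt y' (by omega)]; exact isTopVector_pos hc' hy' ⟨0, by omega⟩
  have he1' : 0 < ext0 y' 1 := by rw [ext0_of_lt y' (by omega)]; exact isTopVector_pos hc' hy' ⟨1, by omega⟩
  -- the two eigen-relations, as `q(1 − r²) = δ r` for `r = e₀/e₁`
  have rel := two_level_relation hy
  have rel' := two_level_relation hy'
  set r := ext0 y 0 / ext0 y 1 with hr
  set r' := ext0 y' 0 / ext0 y' 1 with hr'
  have hrpos : 0 < r := div_pos he0 he1
  have hr'pos : 0 < r' := div_pos he0' he1'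
  have hq : cK n ((n - 3 : ℕ) : ℤ) η 0 * (1 - r ^ 2)
      = (pK n ((n - 3 : ℕ) : ℤ) η 1 - pK n ((n - 3 : ℕ) : ℤ) η 0) * r := by
    have hne : ext0 y 1 ≠ 0 := he1.ne'
    rw [hr]; field_simp; linear_combination rel
  have hq' : cK n ((n - 2 : ℕ) : ℤ) η 0 * (1 - r' ^ 2)
      = (pK n ((n - 2 : ℕ) : ℤ) η 1 - pK n ((n - 2 : ℕ) : ℤ) η 0) * r' := by
    have hne : ext0 y' 1 ≠ 0 := he1'.ne'
    rw [hr']; field_simp; linear_combination rel'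
  have hcmp := delta_mul_c_le hn hη
  have hrr : r' ≤ r := two_level_ratio_le (hc 0 (by omega)) (hc' 0 (by omega)) hrpos hr'pos hq hq' hcmp
  -- adjacent ratio dominance `e₁ e'₀ ≤ e'₁ e₀`
  have hadj : ∀ k, k + 1 < 2 → ext0 y (k + 0 + 1) * ext0 y' k ≤ ext0 y' (k + 1) * ext0 y (k + 0) := by
    intro k hk
    have hk0 : k = 0 := by omega
    subst hk0
    simp only [zero_add, add_zero]
    have : ext0 y' 0 / ext0 y' 1 ≤ ext0 y 0 / ext0 y 1 := hrr
    rw [div_le_div_iff₀ he1' he1] at this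
    linarith
  -- means climb
  have hjm : jMin n ((n - 2 : ℕ) : ℤ) = jMin n ((n - 3 : ℕ) : ℤ) := by rw [jMin_topM2 hn, jMin_topM1 hn]
  have hf : ∀ k, fK n ((n - 2 : ℕ) : ℤ) k = fK n ((n - 3 : ℕ) : ℤ) (k + 0) := by
    intro k; unfold fK lev; rw [hjm, add_zero]
  have hmono : ∀ k l, k ≤ l → l < 2 + 0 → fK n ((n - 3 : ℕ) : ℤ) k ≤ fK n ((n - 3 : ℕ) : ℤ) l :=
    fun k l hkl _ => fK_mono n _ hkl
  have hey2 : ∀ j, j < 2 + 0 → 0 < ext0 y j := by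
    intro j hj
    rcases Nat.lt_succ_iff_lt_or_eq.mp (show j < 1 + 1 by omega) with h | h
    · have : j = 0 := by omega
      subst this; exact he0
    · subst h; exact he1
  have hey'2 : ∀ k, k < 2 → 0 < ext0 y' k := by
    intro k hk
    rcases Nat.lt_succ_iff_lt_or_eq.mp (show k < 1 + 1 by omega) with h | h
    · have : k = 0 := by omega
      subst this; exact he0'
    · subst h; exact he1'
  have key := mean_le_mean_of_adjacent (m' := 2) (s := 0) (by omega) (ext0 y) (ext0 y') (fK n ((n - 3 : ℕ) : ℤ))
    hey2 hey'2 hmono hadj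
  rw [casimirMean_eq, casimirMean_eq, ← hey, ← hey']
  simp only [h1, h2, hf]
  simpa using key

end TopLink

end Summit.HubbardSuperconductivity.HubbardSuperconductivity.Theorems.AnisotropyChord.Knn
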